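import Literature.MathematicalPhysics.QuantumManyBody.BoseGasHardLayerHardy
import Literature.MathematicalPhysics.QuantumManyBody.BoseGasPairVolume
import HarnessLib

/-!
# The mass of a finite-energy function in the hard layers is `o(s²)`

Topic `Literature/MathematicalPhysics/QuantumManyBody`, sequel of `BoseGasHardCrossingLines.lean`, `BoseGasHardLayerHardy.lean` and
`BoseGasPairVolume.lean`. The key estimate of the form-core theorem for hard-core pair potentials: for a bounded function
`η` on `(ℝ/ℤ)^{3N}` which along every coordinate is ACL on almost every line with square-integrable line derivative
`H_q` and locally finite line potential energy (the ACL representatives of a bounded element of the maximal form domain),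
the mass in the hard layer of width `s` is `o(s²)` as `s → 0`:

* `exists_notMem_hardZone` / `iInter_preimage_hardZone_eq_empty` — the transition zones shrink to nothing;
* `tendsto_zoneEnergy` — hence the directional energy in the transition zone tends to `0`;
* `hardLayer_subset` — the hard layer of width `s` is covered by the hard configurations, the dyadic pieces
  `LayerA(s/3^{j+1})` and the near-coincidence sets `{some pair-image radius < 40 s/3^{j+1}}`;
* `exists_setLIntegral_hardLayer_le` — **for every `ε > 0` there is `s₀ > 0` with
  `∫_{fromUnitTorusN L ⁻¹' hardLayer v L s} |η|² ≤ ε s²` for all `0 < s ≤ s₀`.**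

Tagged folklore ([LSSY2005] Ch. 2 (2.1): hard cores in the standing class of interactions).
-/

noncomputable section

open MeasureTheory Set Metric Filter Topology
open scoped ENNReal

namespace Literature.MathematicalPhysics.QuantumManyBody.BoseGas

-- The measure on `ℝ/ℤ` is the Haar PROBABILITY measure, as in `PeriodicFormDomain.lean`.
attribute [local instance] formDomain_measureSpace formDomain_isProbabilityMeasure formDomain_isProbabilityMeasure_pi

variable {N : ℕ} {L : ℝ} {v : ℝ → ℝ≥0∞}

namespace HardLayerAux

/-- Lattice vectors in a ball are finitely many. [folklore] -/
theorem finite_latticeVec_norm_le (hL : 0 < L) (M : ℝ) : {n : Fin 3 → ℤ | ‖latticeVec L n‖ ≤ M}.Finite := by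
  refine (Set.Finite.pi (t := fun _ : Fin 3 => Icc (-⌈M / L⌉) ⌈M / L⌉) fun _ => Set.finite_Icc _ _).subset ?_
  intro n hn
  rw [mem_setOf_eq] at hn
  refine mem_univ_pi.2 fun k => ?_
  have h1 : |latticeVec L n k| ≤ ‖latticeVec L n‖ := abs_le_of_sq_le_sq (sq_apply_le_norm_sq _ k) (norm_nonneg _)
  rw [latticeVec_apply, abs_mul, abs_of_pos hL] at h1
  have h2 : |(n k : ℝ)| ≤ M / L := by rw [le_div_iff₀ hL, mul_comm]; exact h1.trans hn
  have h3 : |(n k : ℝ)| ≤ ⌈M / L⌉ := h2.trans (Int.le_ceil _)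
  rw [mem_Icc, ← abs_le]
  exact_mod_cast h3

/-- For a fixed configuration and bounded hard radii, the image pairs whose radius is within `3` of the hard radii are
finitely many. [folklore] -/
theorem finite_pairRad_le (hL : 0 < L) (X : Config N) (M : ℝ) :
    {p : (Fin N × Fin N) × (Fin 3 → ℤ) | pairRad L X p.1.1 p.1.2 p.2 ≤ M}.Finite := by
  have h : {p : (Fin N × Fin N) × (Fin 3 → ℤ) | pairRad L X p.1.1 p.1.2 p.2 ≤ M} ⊆
      ⋃ ij : Fin N × Fin N, (fun n => (ij, n)) '' {n : Fin 3 → ℤ | ‖latticeVec L n‖ ≤ ‖X ij.1 - X ij.2‖ + M} := by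
    rintro ⟨ij, n⟩ hp
    rw [mem_setOf_eq, pairRad] at hp
    refine mem_iUnion.2 ⟨ij, ⟨n, ?_, rfl⟩⟩
    rw [mem_setOf_eq]
    have := norm_sub_norm_le (latticeVec L n) (X ij.1 - X ij.2)
    rw [← norm_neg (latticeVec L n - (X ij.1 - X ij.2)), neg_sub] at this
    linarith
  exact (Set.finite_iUnion fun ij => (finite_latticeVec_norm_le hL _).image _).subset h

/-- **The transition zones shrink to nothing**: every configuration lies outside `hardZone v L s` for some `s > 0`
(bounded hard radii). [folklore] -/
theorem exists_notMem_hardZone (hL : 0 < L) {R₀ : ℝ} (hSR : ∀ b ∈ hardRad v, b ≤ R₀) (hS : (hardRad v).Nonempty)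
    (X : Config N) : ∃ s : ℝ, 0 < s ∧ X ∉ (hardZone v L s : Set (Config N)) := by
  classical
  -- the finitely many positive distances of relevant image pairs
  set P : Set ℝ := (fun p : (Fin N × Fin N) × (Fin 3 → ℤ) => infDist (pairRad L X p.1.1 p.1.2 p.2) (hardRad v)) ''
    ({p | pairRad L X p.1.1 p.1.2 p.2 ≤ R₀ + 3} ∩ {p | 0 < infDist (pairRad L X p.1.1 p.1.2 p.2) (hardRad v)}) with hP
  have hPfin : P.Finite := ((finite_pairRad_le hL X (R₀ + 3)).subset inter_subset_left).image _
  have hPpos : ∀ d ∈ P, 0 < d := by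
    rintro d ⟨p, hp, rfl⟩; exact hp.2
  -- a positive lower bound of `P ∪ {3}`
  obtain ⟨δ, hδ, hδP⟩ : ∃ δ : ℝ, 0 < δ ∧ δ ≤ 3 ∧ ∀ d ∈ P, δ ≤ d := by
    rcases P.eq_empty_or_nonempty with h | h
    · exact ⟨3, by norm_num, le_rfl, fun d hd => by rw [h] at hd; exact hd.elim⟩
    · refine ⟨min 3 (hPfin.toFinset.min' (by simpa using h)), lt_min (by norm_num) ?_, min_le_left _ _, fun d hd => ?_⟩
      · exact hPpos _ (by simpa using hPfin.toFinset.min'_mem (by simpa using h))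
      · exact (min_le_right _ _).trans (hPfin.toFinset.min'_le d (by simpa using hd))
  refine ⟨δ / 4, by positivity, ?_⟩
  rintro ⟨i, j, n, -, hpos, hle⟩
  -- the witnessing pair is relevant, so its distance is at least `δ`
  have hrad : pairRad L X i j n ≤ R₀ + 3 := by
    obtain ⟨b, hb⟩ := hS
    have h1 : infDist (pairRad L X i j n) (hardRad v) ≤ 3 * (δ / 4) := hle
    have h2 : pairRad L X i j n - R₀ ≤ infDist (pairRad L X i j n) (hardRad v) := by
      refine (le_infDist ⟨b, hb⟩).2 fun c hc => ?_
      rw [Real.dist_eq]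
      have := hSR c hc
      calc pairRad L X i j n - R₀ ≤ pairRad L X i j n - c := by linarith
        _ ≤ |pairRad L X i j n - c| := le_abs_self _
    linarith
  have hmem : infDist (pairRad L X i j n) (hardRad v) ∈ P := ⟨((i, j), n), ⟨hrad, hpos⟩, rfl⟩
  have := hδP.2 _ hmem
  linarith [hδP.1]

/-- The pulled-back transition zones of widths `1/(m+1)` have empty intersection. [folklore] -/
theorem iInter_preimage_hardZone_eq_empty (hL : 0 < L) {R₀ : ℝ} (hSR : ∀ b ∈ hardRad v, b ≤ R₀)
    (hS : (hardRad v).Nonempty) :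
    ⋂ m : ℕ, fromUnitTorusN L ⁻¹' (hardZone v L (1 / ((m : ℝ) + 1)) : Set (Config N)) =
      (∅ : Set (UnitAddTorus (Fin N × Fin 3))) := by
  refine eq_empty_iff_forall_notMem.2 fun t ht => ?_
  rw [mem_iInter] at ht
  obtain ⟨s, hs, hX⟩ := exists_notMem_hardZone hL hSR hS (fromUnitTorusN L t)
  obtain ⟨m, hm⟩ := exists_nat_one_div_lt hs
  exact hX (hardZone_mono v L hm.le (ht m))

/-- **The directional energy in the transition zone tends to zero** along the widths `1/(m+1)`. [folklore] -/
theorem tendsto_zoneEnergy (hL : 0 < L) {R₀ : ℝ} (hSR : ∀ b ∈ hardRad v, b ≤ R₀) (hS : (hardRad v).Nonempty)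
    {F : UnitAddTorus (Fin N × Fin 3) → ℝ≥0∞} (hF : ∫⁻ t, F t ≠ ⊤) :
    Tendsto (fun m : ℕ => ∫⁻ t in fromUnitTorusN L ⁻¹' (hardZone v L (1 / ((m : ℝ) + 1)) : Set (Config N)), F t)
      atTop (𝓝 0) := by
  set μ : Measure (UnitAddTorus (Fin N × Fin 3)) := volume.withDensity F with hμ
  have hmeas : ∀ m : ℕ, MeasurableSet (fromUnitTorusN L ⁻¹' (hardZone v L (1 / ((m : ℝ) + 1)) : Set (Config N))) :=
    fun m => (measurableSet_hardZone v L _).preimage (measurable_fromUnitTorusN L)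
  have heq : ∀ m : ℕ, ∫⁻ t in fromUnitTorusN L ⁻¹' (hardZone v L (1 / ((m : ℝ) + 1)) : Set (Config N)), F t =
      μ (fromUnitTorusN L ⁻¹' (hardZone v L (1 / ((m : ℝ) + 1)) : Set (Config N))) := fun m =>
    (withDensity_apply F (hmeas m)).symm
  simp only [heq]
  have h := tendsto_measure_iInter_atTop (μ := μ)
    (s := fun m : ℕ => fromUnitTorusN L ⁻¹' (hardZone v L (1 / ((m : ℝ) + 1)) : Set (Config N)))
    (fun m => (hmeas m).nullMeasurableSet) (fun m m' hmm' => preimage_mono (hardZone_mono v L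
      (one_div_le_one_div_of_le (by positivity) (by exact_mod_cast Nat.succ_le_succ hmm'))))
    ⟨0, by rw [withDensity_apply F (hmeas 0)]; exact ne_top_of_le_ne_top hF (setLIntegral_le_lintegral _ _)⟩
  rwa [iInter_preimage_hardZone_eq_empty hL hSR hS, measure_empty] at h

/-- Indicator of a preimage times a function, integrated, is the set integral over the preimage. [folklore] -/
theorem lintegral_indicator_preimage_mul {A : Set (Config N)} (hA : MeasurableSet A) (L : ℝ)
    (F : UnitAddTorus (Fin N × Fin 3) → ℝ≥0∞) :
    ∫⁻ t, A.indicator (1 : Config N → ℝ≥0∞) (fromUnitTorusN L t) * F t = ∫⁻ t in fromUnitTorusN L ⁻¹' A, F t := by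
  rw [← lintegral_indicator (hA.preimage (measurable_fromUnitTorusN L))]
  refine lintegral_congr fun t => ?_
  by_cases ht : fromUnitTorusN L t ∈ A
  · rw [indicator_of_mem ht, indicator_of_mem (show t ∈ fromUnitTorusN L ⁻¹' A from ht), Pi.one_apply, one_mul]
  · rw [indicator_of_notMem ht, indicator_of_notMem (show t ∉ fromUnitTorusN L ⁻¹' A from ht), zero_mul]

/-- `∑ⱼ 2^{-(j+1)} = 1` in `ℝ≥0∞`. [folklore] -/
theorem tsum_two_inv_pow_succ : ∑' j : ℕ, ((2 : ℝ≥0∞)⁻¹) ^ (j + 1) = 1 := by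
  simp only [pow_succ', ENNReal.tsum_mul_left, ENNReal.tsum_geometric, ENNReal.one_sub_inv_two, inv_inv]
  exact ENNReal.inv_mul_cancel (by norm_num) (by norm_num)

/-- The dyadic scales: `ε (s/3^{j+1})² ≤ ε s² 2^{-(j+1)}` in `ℝ≥0∞`. [folklore] -/
theorem ofReal_dyadic_le {ε s : ℝ} (hε : 0 ≤ ε) (j : ℕ) :
    ENNReal.ofReal (ε * (s / 3 ^ (j + 1)) ^ 2) ≤ ENNReal.ofReal (ε * s ^ 2) * ((2 : ℝ≥0∞)⁻¹) ^ (j + 1) := by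
  rw [show ((2 : ℝ≥0∞)⁻¹) ^ (j + 1) = ENNReal.ofReal ((1 / 2) ^ (j + 1)) by
    rw [ENNReal.ofReal_pow (by norm_num), one_div, ENNReal.ofReal_inv_of_pos (by norm_num), ENNReal.ofReal_ofNat],
    ← ENNReal.ofReal_mul (by positivity)]
  refine ENNReal.ofReal_le_ofReal ?_
  have h3 : (2 : ℝ) ^ (j + 1) ≤ (3 ^ (j + 1)) ^ 2 :=
    calc (2 : ℝ) ^ (j + 1) ≤ 3 ^ (j + 1) := pow_le_pow_left₀ (by norm_num) (by norm_num) _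
      _ ≤ (3 ^ (j + 1)) ^ 2 := le_self_pow₀ (one_le_pow₀ (by norm_num)) two_ne_zero
  rw [div_pow, one_div_pow, mul_one_div, ← mul_div_assoc]
  exact div_le_div_of_nonneg_left (by positivity) (by positivity) h3

end HardLayerAux

open HardLayerAux

/-- **The hard layer is covered by the hard configurations, the dyadic `LayerA` pieces and the near-coincidences.**
For `s > 0`: a configuration with an image pair within `s` of a hard radius is either ON a hard sphere, or the distance
`d` lies in `(s/3^{j+1}, s/3^j]` for some `j`, and then the pair has radius `≥ 40 s/3^{j+1}` (a `LayerA(s/3^{j+1})`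
configuration) or `< 40 s/3^{j+1}` (a near-coincidence). [folklore] -/
theorem preimage_hardLayer_subset (L : ℝ) {s : ℝ} (hs : 0 < s) :
    fromUnitTorusN L ⁻¹' (hardLayer v L s : Set (Config N)) ⊆
      fromUnitTorusN L ⁻¹' (hardLayer v L 0 : Set (Config N)) ∪
      ⋃ j : ℕ, ({t : UnitAddTorus (Fin N × Fin 3) | ∃ (i j' : Fin N) (n : Fin 3 → ℤ), i ≠ j' ∧
          0 < infDist (pairRad L (fromUnitTorusN L t) i j' n) (hardRad v) ∧
          infDist (pairRad L (fromUnitTorusN L t) i j' n) (hardRad v) ≤ 3 * (s / 3 ^ (j + 1)) ∧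
          40 * (s / 3 ^ (j + 1)) ≤ pairRad L (fromUnitTorusN L t) i j' n} ∪
        {t : UnitAddTorus (Fin N × Fin 3) | ∃ (i j' : Fin N) (n : Fin 3 → ℤ), i ≠ j' ∧
          pairRad L (fromUnitTorusN L t) i j' n < 40 * (s / 3 ^ (j + 1))}) := by
  rintro t ⟨i, j', n, hij, hle⟩
  by_cases h0 : infDist (pairRad L (fromUnitTorusN L t) i j' n) (hardRad v) ≤ 0
  · exact Or.inl ⟨i, j', n, hij, h0⟩
  push Not at h0
  set d : ℝ := infDist (pairRad L (fromUnitTorusN L t) i j' n) (hardRad v) with hd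
  obtain ⟨m, hm1, hm2⟩ := exists_nat_pow_near (x := s / d) ((one_le_div h0).2 hle) (y := 3) (by norm_num)
  refine Or.inr (mem_iUnion.2 ⟨m, ?_⟩)
  have h3 : d ≤ 3 * (s / 3 ^ (m + 1)) := by
    rw [show 3 * (s / 3 ^ (m + 1)) = s / 3 ^ m by rw [pow_succ]; field_simp]
    rw [le_div_iff₀ (by positivity)]
    have := (le_div_iff₀ h0).1 hm1
    linarith
  by_cases hrad : 40 * (s / 3 ^ (m + 1)) ≤ pairRad L (fromUnitTorusN L t) i j' n
  · exact Or.inl ⟨i, j', n, hij, h0, h3, hrad⟩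
  · exact Or.inr ⟨i, j', n, hij, not_le.1 hrad⟩

/-- **The mass in the hard layers is `o(s²)`.** Let `v` be measurable with nonempty hard radii bounded by `R₀`, `L > 0`,
and `η` a function on `(ℝ/ℤ)^{3N}` bounded by `k` a.e. such that for every coordinate `q` there are `G_q = η` a.e. and
a measurable square-integrable `H_q` with, for a.e. `t`, the ACL property of `G_q` along the `q`-line through `t`
(derivative `H_q`) and locally finite line potential energy. Then for every `ε > 0` there is `s₀ > 0` such that
`∫_{fromUnitTorusN L ⁻¹' hardLayer v L s} |η|² ≤ ε s²` for all `0 < s ≤ s₀`. [folklore] -/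
theorem exists_setLIntegral_hardLayer_le (hL : 0 < L) (hv : Measurable v) {R₀ : ℝ} (hSR : ∀ b ∈ hardRad v, b ≤ R₀)
    (hS : (hardRad v).Nonempty)
    {η : UnitAddTorus (Fin N × Fin 3) → ℂ} {G H : Fin N × Fin 3 → UnitAddTorus (Fin N × Fin 3) → ℂ}
    (hGη : ∀ q, G q =ᵐ[volume] η) (hHm : ∀ q, Measurable (H q)) (hHfin : ∀ q, ∫⁻ t, ‖H q t‖ₑ ^ 2 ≠ ⊤)
    (hgood : ∀ q : Fin N × Fin 3, ∀ᵐ t ∂(volume : Measure (UnitAddTorus (Fin N × Fin 3))),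
      (∀ a b : ℝ, IntervalIntegrable (fun x : ℝ => H q (t + Pi.single q ((x : ℝ) : UnitAddCircle))) volume a b ∧
        G q (t + Pi.single q ((b : ℝ) : UnitAddCircle)) - G q (t + Pi.single q ((a : ℝ) : UnitAddCircle)) =
          ∫ x in a..b, H q (t + Pi.single q ((x : ℝ) : UnitAddCircle))) ∧
      (∀ a b : ℝ, ∫⁻ x in Ioo a b, periodicInteraction v L
        (fromUnitTorusN L (t + Pi.single q ((x : ℝ) : UnitAddCircle))) *
          ‖G q (t + Pi.single q ((x : ℝ) : UnitAddCircle))‖ₑ ^ 2 ≠ ⊤))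
    {k : ℝ} (hηk : ∀ᵐ t ∂(volume : Measure (UnitAddTorus (Fin N × Fin 3))), ‖η t‖ ≤ k) {ε : ℝ} (hε : 0 < ε) :
    ∃ s₀ : ℝ, 0 < s₀ ∧ ∀ s : ℝ, 0 < s → s ≤ s₀ →
      ∫⁻ t in fromUnitTorusN L ⁻¹' (hardLayer v L s : Set (Config N)), ‖η t‖ₑ ^ 2 ≤ ENNReal.ofReal (ε * s ^ 2) := by
  -- the zone energy and its smallness
  obtain ⟨Z, hZ⟩ : ∃ Z : ℝ → ℝ≥0∞, ∀ s, Z s = ∑ q : Fin N × Fin 3,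
      ∫⁻ t, (hardZone v L s : Set (Config N)).indicator (1 : Config N → ℝ≥0∞) (fromUnitTorusN L t) * ‖H q t‖ₑ ^ 2 :=
    ⟨_, fun _ => rfl⟩
  have hZmono : ∀ {s s' : ℝ}, s ≤ s' → Z s ≤ Z s' := fun {s s'} h => by
    rw [hZ, hZ]
    refine Finset.sum_le_sum fun q _ => lintegral_mono fun t => ?_
    have hind : (hardZone v L s : Set (Config N)).indicator (1 : Config N → ℝ≥0∞) (fromUnitTorusN L t) ≤
        (hardZone v L s' : Set (Config N)).indicator (1 : Config N → ℝ≥0∞) (fromUnitTorusN L t) :=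
      indicator_le_indicator_of_subset (hardZone_mono v L h) (fun _ => zero_le) _
    exact mul_le_mul_left hind _
  have hZlim : Tendsto (fun m : ℕ => Z (1 / ((m : ℝ) + 1))) atTop (𝓝 0) := by
    have h := tendsto_finsetSum (Finset.univ : Finset (Fin N × Fin 3)) fun q _ =>
      tendsto_zoneEnergy (N := N) hL hSR hS (F := fun t => ‖H q t‖ₑ ^ 2) (hHfin q)
    rw [Finset.sum_const_zero] at h
    refine h.congr fun m => ?_
    rw [hZ]
    exact Finset.sum_congr rfl fun q _ => (lintegral_indicator_preimage_mul (measurableSet_hardZone v L _) L _).symm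
  have hδ₁ : (0 : ℝ≥0∞) < ENNReal.ofReal (ε * L ^ 2 / 484) := ENNReal.ofReal_pos.2 (by positivity)
  obtain ⟨m, hm⟩ := ((tendsto_order.1 hZlim).2 _ hδ₁).exists
  -- the scales
  set s₁ : ℝ := 1 / ((m : ℝ) + 1) with hs₁
  set K : ℝ := k ^ 2 * (N : ℝ) ^ 2 * 320 ^ 3 with hK
  have hK0 : 0 ≤ K := by positivity
  set s₂ : ℝ := ε * L ^ 3 / (2 * (K + 1)) with hs₂
  have hs₂0 : 0 < s₂ := by positivity
  refine ⟨min (min s₁ s₂) (L / 80), lt_min (lt_min (by positivity) hs₂0) (by positivity), fun s hs hs0 => ?_⟩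
  have hss₁ : s ≤ s₁ := hs0.trans ((min_le_left _ _).trans (min_le_left _ _))
  have hss₂ : s ≤ s₂ := hs0.trans ((min_le_left _ _).trans (min_le_right _ _))
  have hsL : s ≤ L / 80 := hs0.trans (min_le_right _ _)
  -- notation for the dyadic pieces
  set sj : ℕ → ℝ := fun j => s / 3 ^ (j + 1) with hsj
  have hsj0 : ∀ j, 0 < sj j := fun j => by positivity
  have hsjs : ∀ j, sj j ≤ s := fun j => by
    rw [hsj]; dsimp only
    rw [div_le_iff₀ (by positivity)]
    exact le_mul_of_one_le_right hs.le (one_le_pow₀ (by norm_num))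
  obtain ⟨A, hA⟩ : ∃ A : ℕ → Set (UnitAddTorus (Fin N × Fin 3)), ∀ j, A j = {t | ∃ (i j' : Fin N) (n : Fin 3 → ℤ), i ≠ j' ∧
      0 < infDist (pairRad L (fromUnitTorusN L t) i j' n) (hardRad v) ∧
      infDist (pairRad L (fromUnitTorusN L t) i j' n) (hardRad v) ≤ 3 * sj j ∧
      40 * sj j ≤ pairRad L (fromUnitTorusN L t) i j' n} := ⟨_, fun _ => rfl⟩
  obtain ⟨B, hB⟩ : ∃ B : ℕ → Set (UnitAddTorus (Fin N × Fin 3)), ∀ j, B j = {t | ∃ (i j' : Fin N) (n : Fin 3 → ℤ), i ≠ j' ∧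
      pairRad L (fromUnitTorusN L t) i j' n < 40 * sj j} := ⟨_, fun _ => rfl⟩
  -- the `LayerA` pieces
  have hAle : ∀ j, ∫⁻ t in A j, ‖η t‖ₑ ^ 2 ≤ ENNReal.ofReal (ε * sj j ^ 2 / 2) := by
    intro j
    have h1 := setLIntegral_layerA_le hL hv hGη hHm hgood (hsj0 j)
    rw [← hA j, ← hZ] at h1
    have h2 : Z (sj j) ≤ ENNReal.ofReal (ε * L ^ 2 / 484) := (hZmono ((hsjs j).trans hss₁)).trans hm.le
    calc ∫⁻ t in A j, ‖η t‖ₑ ^ 2 ≤ ENNReal.ofReal (11 * sj j / L) * ENNReal.ofReal (22 * sj j / L) * Z (sj j) := h1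
      _ ≤ ENNReal.ofReal (11 * sj j / L) * ENNReal.ofReal (22 * sj j / L) * ENNReal.ofReal (ε * L ^ 2 / 484) := by gcongr
      _ = ENNReal.ofReal (ε * sj j ^ 2 / 2) := by
          rw [← ENNReal.ofReal_mul (by positivity), ← ENNReal.ofReal_mul (by positivity)]
          congr 1
          field_simp
          ring
  -- the near-coincidence pieces
  have hη2 : ∀ᵐ t ∂(volume : Measure (UnitAddTorus (Fin N × Fin 3))), ‖η t‖ₑ ^ 2 ≤ ENNReal.ofReal (k ^ 2) := by
    filter_upwards [hηk] with t ht
    have hk0 : 0 ≤ k := (norm_nonneg _).trans ht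
    rw [← ofReal_norm, ← ENNReal.ofReal_pow (norm_nonneg _)]
    exact ENNReal.ofReal_le_ofReal (pow_le_pow_left₀ (norm_nonneg _) ht 2)
  have hBle : ∀ j, ∫⁻ t in B j, ‖η t‖ₑ ^ 2 ≤ ENNReal.ofReal (ε * sj j ^ 2 / 2) := by
    intro j
    have hr : 40 * sj j ≤ L / 2 := by linarith [hsjs j]
    have hvol := volume_exists_pairRad_lt_le (N := N) hL (by positivity : 0 < 40 * sj j) hr
    rw [← hB j] at hvol
    calc ∫⁻ t in B j, ‖η t‖ₑ ^ 2 ≤ ∫⁻ _t in B j, ENNReal.ofReal (k ^ 2) := lintegral_mono_ae (ae_restrict_of_ae hη2)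
      _ = ENNReal.ofReal (k ^ 2) * volume (B j) := setLIntegral_const _ _
      _ ≤ ENNReal.ofReal (k ^ 2) * ((N : ℝ≥0∞) ^ 2 * ENNReal.ofReal (8 * (40 * sj j) / L) ^ 3) := by gcongr
      _ = ENNReal.ofReal (K * sj j ^ 3 / L ^ 3) := by
          rw [← ENNReal.ofReal_natCast, ← ENNReal.ofReal_pow (Nat.cast_nonneg _), ← ENNReal.ofReal_pow (by positivity),
            ← ENNReal.ofReal_mul (by positivity), ← ENNReal.ofReal_mul (by positivity)]
          congr 1
          rw [hK]
          field_simp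
          ring
      _ ≤ ENNReal.ofReal (ε * sj j ^ 2 / 2) := by
          refine ENNReal.ofReal_le_ofReal ?_
          rw [div_le_iff₀ (by positivity)]
          have h1 : sj j ≤ s₂ := (hsjs j).trans hss₂
          have h2 : K * sj j ≤ K * s₂ := mul_le_mul_of_nonneg_left h1 hK0
          have h3 : K * s₂ ≤ ε * L ^ 3 / 2 := by
            rw [hs₂, mul_div_assoc', div_le_div_iff₀ (by positivity) (by positivity)]
            nlinarith [mul_pos hε (pow_pos hL 3)]
          have h4 : 0 ≤ sj j ^ 2 := sq_nonneg _
          nlinarith [mul_le_mul_of_nonneg_right (h2.trans h3) h4]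
  -- each dyadic piece
  have hTle : ∀ j, ∫⁻ t in A j ∪ B j, ‖η t‖ₑ ^ 2 ≤ ENNReal.ofReal (ε * s ^ 2) * ((2 : ℝ≥0∞)⁻¹) ^ (j + 1) := by
    intro j
    calc ∫⁻ t in A j ∪ B j, ‖η t‖ₑ ^ 2 ≤ (∫⁻ t in A j, ‖η t‖ₑ ^ 2) + ∫⁻ t in B j, ‖η t‖ₑ ^ 2 := lintegral_union_le _ _ _
      _ ≤ ENNReal.ofReal (ε * sj j ^ 2 / 2) + ENNReal.ofReal (ε * sj j ^ 2 / 2) := add_le_add (hAle j) (hBle j)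
      _ = ENNReal.ofReal (ε * (s / 3 ^ (j + 1)) ^ 2) := by
          rw [← ENNReal.ofReal_add (by positivity) (by positivity)]; congr 1; rw [hsj]; ring
      _ ≤ _ := ofReal_dyadic_le hε.le j
  -- the hard configurations carry no mass
  have h0 : ∫⁻ t in fromUnitTorusN L ⁻¹' (hardLayer v L 0 : Set (Config N)), ‖η t‖ₑ ^ 2 = 0 := by
    have hae := ae_eq_zero_of_mem_hardLayer_zero hL hv hS hGη hgood
    have hmeas : MeasurableSet (fromUnitTorusN L ⁻¹' (hardLayer v L 0 : Set (Config N))) :=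
      (measurableSet_hardLayer v L 0).preimage (measurable_fromUnitTorusN L)
    refine (lintegral_congr_ae ((ae_restrict_iff' hmeas).2 (hae.mono fun t ht hmem => ?_))).trans lintegral_zero
    show ‖η t‖ₑ ^ 2 = 0
    rw [ht hmem]; simp
  -- assemble
  calc ∫⁻ t in fromUnitTorusN L ⁻¹' (hardLayer v L s : Set (Config N)), ‖η t‖ₑ ^ 2
      ≤ ∫⁻ t in fromUnitTorusN L ⁻¹' (hardLayer v L 0 : Set (Config N)) ∪ ⋃ j : ℕ, (A j ∪ B j), ‖η t‖ₑ ^ 2 := by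
        refine lintegral_mono_set ((preimage_hardLayer_subset (N := N) (v := v) L hs).trans
          (union_subset_union_right _ (iUnion_mono fun j => ?_)))
        rw [hA j, hB j]
    _ ≤ (∫⁻ t in fromUnitTorusN L ⁻¹' (hardLayer v L 0 : Set (Config N)), ‖η t‖ₑ ^ 2) +
          ∫⁻ t in ⋃ j : ℕ, (A j ∪ B j), ‖η t‖ₑ ^ 2 := lintegral_union_le _ _ _
    _ ≤ 0 + ∑' j : ℕ, ∫⁻ t in A j ∪ B j, ‖η t‖ₑ ^ 2 := by rw [h0]; gcongr; exact lintegral_iUnion_le _ _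
    _ ≤ 0 + ∑' j : ℕ, ENNReal.ofReal (ε * s ^ 2) * ((2 : ℝ≥0∞)⁻¹) ^ (j + 1) := by gcongr with j; exact hTle j
    _ = ENNReal.ofReal (ε * s ^ 2) := by rw [zero_add, ENNReal.tsum_mul_left, tsum_two_inv_pow_succ, mul_one]

end Literature.MathematicalPhysics.QuantumManyBody.BoseGas

end
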